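/-
VALUE = THEOREM, NOT summit progress (cell b2b-lgcu-borel, gen 25); crux 14079 untouched.
-/
import Mathlib
import Summits.MatrixMultiplication.MatrixMultiplication.Theorems.SubgroupIdentityDesigns.Negative.OppositeRootPairs
import Summits.MatrixMultiplication.MatrixMultiplication.Theorems.SubgroupIdentityDesigns.Negative.WitnessProfile

/-!
# Two distinct subgroups of order `p` of `GL₂(𝔽_p)` generate a conjugate of `SL₂(𝔽_p)`

VALUE = THEOREM (the prime-field case of Dickson's generation lemma for `GL₂`, recorded as the
two-dimensional input of the case-(S) analysis of HYPOTHETICAL level-one witnesses of the crux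
`SubgroupIdentityDesigns`, `m = 3`, `k = 1`), NOT summit progress.  The crux item is neither
restated nor weakened; this file is a `--supports` helper under `Negative/`.

THEOREM (`exists_conj_sl2_subset`, every prime `p`).  If `T₁ ≠ T₂` are subgroups of order `p`
of `GL₂(𝔽_p)`, both contained in a subgroup `K`, then `g · SL₂(𝔽_p) · g⁻¹ ⊆ K` for some
`g ∈ GL₂(𝔽_p)`; in particular (`card_SL2`, `le_card_of_two_subgroups`)
`p (p² − 1) = |SL₂(𝔽_p)| ≤ |K|`.

PROOF.  An element `t ≠ 1` with `t ^ p = 1` is `1 + N` with `N ^ p = 0`, so `N² = 0`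
(Cayley–Hamilton) and `N = c ⊗ δ` with `δ(c) = 0`, `c, δ ≠ 0` (`transvection_of_pow_prime`).
A subgroup of order `p` is cyclic, hence of the form `{1 + y · c ⊗ δ : y ∈ 𝔽_p}`
(`subgroup_shape`).  In dimension two the annihilator of `c ≠ 0` is a line (`perp_unique`), so
the centre `⟨c⟩` determines `c ⊗ δ` up to scalars; therefore `T₁ ≠ T₂` forces independent
centres `c₁, c₂` (`centres_independent`), and then `δ₁(c₂) ≠ 0 ≠ δ₂(c₁)`.  In the frame
`F = (c₁ | c₂)` the two groups become the root groups `{u_y}`, `{u⁻_z}` of `SL₂(𝔽_p)`, which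
generate it (`OppositeRootPairs.mem_of_root_elements`).  The order of `SL₂(𝔽_p)` is computed from
`WitnessProfile.card_GL2` and the determinant sequence `1 → SL₂ → GL₂ → 𝔽_pˣ → 1`.

USE (successor target S-16 of the cell, ORACLE-g25 §G25-5): the numerical input `|H̄| ≥ p (p² − 1)`
for the 2-dimensional sub/quotient action of a reducible case-(S) member of a `(3,1)`-witness
(`MemberTrichotomy.member_classification`) in the planned proof that case-(S) members are irreducible.

HONEST SCOPE.  Classical linear algebra over `𝔽_p`; no TPP, no design.  Sorry-free; standard
axioms.
-/

set_option linter.dupNamespace false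

noncomputable section

open scoped BigOperators Classical Matrix

namespace Summit.MatrixMultiplication.MatrixMultiplication.Theorems.SubgroupIdentityDesigns.Negative
namespace TransvectionPairGL2

open Summit.MatrixMultiplication.MatrixMultiplication.Theorems.LieRankDesigns.Negative (GLm Mat)
open Matrix (vecMulVec)
open CuspidalObstruction (SL2 ux lx coe_ux coe_lx)

variable {p : ℕ} [hp : Fact p.Prime]

/-! ## 1. Elements and subgroups of order `p` of `GL₂(𝔽_p)` -/

section Shape

/-- `u ^ p = 1` in `GL₂(𝔽_p)` forces `(u − 1) ^ p = 0`. -/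
theorem sub_one_pow_prime {u : GLm p 2} (hu : u ^ p = 1) : ((u : Mat p 2) - 1) ^ p = 0 := by
  have h1 : (u : Mat p 2) = 1 + ((u : Mat p 2) - 1) := by rw [add_sub_cancel]
  have h := congrArg (fun g : GLm p 2 => (g : Mat p 2)) hu
  simp only [Units.val_pow_eq_pow_val, Units.val_one] at h
  rw [h1, add_pow_char_of_commute p (Commute.one_left _), one_pow] at h
  exact add_eq_left.mp h

/-- A nilpotent `2 × 2` matrix has square zero (Cayley–Hamilton). -/
theorem mul_self_eq_zero {N : Mat p 2} (hnil : IsNilpotent N) : N * N = 0 := by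
  have h := (Matrix.isNilpotent_charpoly_sub_pow_of_isNilpotent hnil).eq_zero
  rw [sub_eq_zero, Fintype.card_fin] at h
  have h2 := Matrix.aeval_self_charpoly N
  rw [h, map_pow, Polynomial.aeval_X, pow_two] at h2
  exact h2

/-- A non-zero `N ∈ Mat₂(𝔽_p)` with `N² = 0` is `c ⊗ δ` with `c ≠ 0`, `δ ≠ 0`, `δ(c) = 0`. -/
theorem exists_vecMulVec_of_sq_zero {N : Mat p 2} (hN : N ≠ 0) (hNN : N * N = 0) :
    ∃ c δ : Fin 2 → ZMod p, c ≠ 0 ∧ δ ≠ 0 ∧ δ ⬝ᵥ c = 0 ∧ N = vecMulVec c δ := by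
  have hrank : N.rank ≤ 1 := by
    have hcomp : N.mulVecLin ∘ₗ N.mulVecLin = 0 := by
      rw [← Matrix.mulVecLin_mul, hNN, Matrix.mulVecLin_zero]
    have hle : LinearMap.range N.mulVecLin ≤ LinearMap.ker N.mulVecLin :=
      LinearMap.range_le_ker_iff.mpr hcomp
    have h1 := Submodule.finrank_mono hle
    have h2 := LinearMap.finrank_range_add_finrank_ker N.mulVecLin
    rw [Module.finrank_fin_fun] at h2
    unfold Matrix.rank
    omega
  obtain ⟨c, δ, hcδ⟩ := exists_eq_vecMulVec_of_rank_le_one_gl N hrank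
  have hne : vecMulVec c δ ≠ 0 := hcδ ▸ hN
  rw [Ne, Matrix.vecMulVec_eq_zero, not_or] at hne
  have hδc : δ ⬝ᵥ c = 0 := by
    have h := hNN
    rw [hcδ, RootElements.vmv_mul_vmv, smul_eq_zero] at h
    exact h.resolve_right (hcδ ▸ hN)
  exact ⟨c, δ, hne.1, hne.2, hδc, hcδ⟩

/-- An element `t ≠ 1` of `GL₂(𝔽_p)` with `t ^ p = 1` is a transvection `1 + c ⊗ δ`,
`δ(c) = 0`, `c ≠ 0`, `δ ≠ 0`. -/
theorem transvection_of_pow_prime {t : GLm p 2} (ht : t ^ p = 1) (ht1 : t ≠ 1) :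
    ∃ c δ : Fin 2 → ZMod p, c ≠ 0 ∧ δ ≠ 0 ∧ δ ⬝ᵥ c = 0 ∧ (t : Mat p 2) = 1 + vecMulVec c δ := by
  have hN : (t : Mat p 2) - 1 ≠ 0 :=
    fun h => ht1 (Units.ext (by rw [Units.val_one]; exact sub_eq_zero.mp h))
  have hsq := mul_self_eq_zero ⟨p, sub_one_pow_prime ht⟩
  obtain ⟨c, δ, hc, hδ, hδc, hN'⟩ := exists_vecMulVec_of_sq_zero hN hsq
  exact ⟨c, δ, hc, hδ, hδc, by rw [← hN', add_sub_cancel]⟩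

/-- **Shape of a subgroup of order `p`.**  A subgroup `T ≤ GL₂(𝔽_p)` of order `p` is the full
transvection group `{1 + y · c ⊗ δ : y ∈ 𝔽_p}` of some root datum `(c, δ)`, `δ(c) = 0`. -/
theorem subgroup_shape (T : Subgroup (GLm p 2)) (hT : Nat.card T = p) :
    ∃ c δ : Fin 2 → ZMod p, c ≠ 0 ∧ δ ≠ 0 ∧ δ ⬝ᵥ c = 0 ∧
      (∀ t ∈ T, ∃ y : ZMod p, (t : Mat p 2) = 1 + y • vecMulVec c δ) ∧
      (∀ y : ZMod p, ∃ t ∈ T, (t : Mat p 2) = 1 + y • vecMulVec c δ) := by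
  haveI : Nontrivial T := Finite.one_lt_card_iff_nontrivial.mp (by rw [hT]; exact hp.out.one_lt)
  obtain ⟨x, hx1⟩ := exists_ne (1 : T)
  have hxp : (x : GLm p 2) ^ p = 1 := by
    have h' := congrArg (fun y : T => (y : GLm p 2)) (hT ▸ (pow_card_eq_one' : x ^ Nat.card T = 1))
    simpa only [SubgroupClass.coe_pow, OneMemClass.coe_one] using h'
  have hx1' : (x : GLm p 2) ≠ 1 := fun h => hx1 (Subtype.ext (by simpa using h))
  obtain ⟨c, δ, hc, hδ, hδc, hx⟩ := transvection_of_pow_prime hxp hx1'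
  have hNN : vecMulVec c δ * vecMulVec c δ = 0 := by rw [RootElements.vmv_mul_vmv, hδc, zero_smul]
  refine ⟨c, δ, hc, hδ, hδc, fun t ht => ?_, fun y => ?_⟩
  · have hmem : (⟨t, ht⟩ : T) ∈ Subgroup.zpowers x := by
      rw [zpowers_eq_top_of_prime_card hT hx1]; exact Subgroup.mem_top _
    rw [← (isOfFinOrder_of_finite x).mem_powers_iff_mem_zpowers, Submonoid.mem_powers_iff] at hmem
    obtain ⟨k, hk⟩ := hmem
    refine ⟨(k : ZMod p), ?_⟩
    have h' := congrArg (fun y : T => ((y : GLm p 2) : Mat p 2)) hk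
    simp only [SubgroupClass.coe_pow] at h'
    rw [← h', RootElements.coe_pow_of_sq_zero hx hNN k]
  · refine ⟨(x : GLm p 2) ^ y.val, T.pow_mem x.2 _, ?_⟩
    rw [RootElements.coe_pow_of_sq_zero hx hNN, ZMod.natCast_zmod_val]

end Shape

/-! ## 2. Two-dimensional geometry: annihilators are lines, distinct groups have independent
centres -/

section Geometry

/-- In `𝔽_p²` the annihilator of a non-zero vector `c` is a line: two functionals vanishing on
`c`, the first non-zero, are proportional. -/
theorem perp_unique {c δ δ' : Fin 2 → ZMod p} (hc : c ≠ 0) (hδ : δ ≠ 0) (h : δ ⬝ᵥ c = 0)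
    (h' : δ' ⬝ᵥ c = 0) : ∃ μ : ZMod p, δ' = μ • δ := by
  simp only [dotProduct, Fin.sum_univ_two] at h h'
  by_cases hc0 : c 0 = 0
  · have hc1 : c 1 ≠ 0 := by
      intro hc1; apply hc; funext i; fin_cases i <;> assumption
    rw [hc0, mul_zero, zero_add] at h h'
    have hδ1 : δ 1 = 0 := (mul_eq_zero.mp h).resolve_right hc1
    have hδ'1 : δ' 1 = 0 := (mul_eq_zero.mp h').resolve_right hc1
    have hδ0 : δ 0 ≠ 0 := by
      intro h0; apply hδ; funext i; fin_cases i <;> assumption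
    refine ⟨δ' 0 / δ 0, funext fun i => ?_⟩
    fin_cases i
    · simp [div_mul_cancel₀ _ hδ0]
    · simp [hδ1, hδ'1]
  · have hδ1 : δ 1 ≠ 0 := by
      intro h1
      have h0 : δ 0 = 0 := by
        rw [h1, zero_mul, add_zero] at h
        exact (mul_eq_zero.mp h).resolve_right hc0
      apply hδ; funext i; fin_cases i <;> assumption
    have e1 : δ 0 = -(δ 1 * c 1) / c 0 := by field_simp; linear_combination h
    have e2 : δ' 0 = -(δ' 1 * c 1) / c 0 := by field_simp; linear_combination h'
    refine ⟨δ' 1 / δ 1, funext fun i => ?_⟩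
    fin_cases i
    · simp only [Fin.zero_eta, Pi.smul_apply, smul_eq_mul]
      rw [e1, e2]
      field_simp
    · simp [div_mul_cancel₀ _ hδ1]

/-- Transvection groups with proportional root data coincide: if every element of `T₂` is
`1 + y · c₂ ⊗ δ₂` and `c₂ ⊗ δ₂ = ν · c₁ ⊗ δ₁`, where `T₁ ⊇ {1 + y · c₁ ⊗ δ₁}`, then `T₂ ≤ T₁`. -/
theorem le_of_smul {T₁ T₂ : Subgroup (GLm p 2)} {c₁ δ₁ c₂ δ₂ : Fin 2 → ZMod p} {ν : ZMod p}
    (h₁ : ∀ y : ZMod p, ∃ t ∈ T₁, (t : Mat p 2) = 1 + y • vecMulVec c₁ δ₁)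
    (h₂ : ∀ t ∈ T₂, ∃ y : ZMod p, (t : Mat p 2) = 1 + y • vecMulVec c₂ δ₂)
    (hν : vecMulVec c₂ δ₂ = ν • vecMulVec c₁ δ₁) : T₂ ≤ T₁ := by
  intro t ht
  obtain ⟨y, hy⟩ := h₂ t ht
  obtain ⟨t', ht', ht'e⟩ := h₁ (y * ν)
  exact (Units.ext (by rw [hy, ht'e, hν, smul_smul]) : t = t') ▸ ht'

/-- **Distinct subgroups of order `p` have independent centres**, and each root functional is
non-zero on the other centre. -/
theorem centres_independent {T₁ T₂ : Subgroup (GLm p 2)} (hT₁ : Nat.card T₁ = p)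
    (hT₂ : Nat.card T₂ = p) (hne : T₁ ≠ T₂) {c₁ δ₁ c₂ δ₂ : Fin 2 → ZMod p} (hc₁ : c₁ ≠ 0)
    (hδ₁ : δ₁ ≠ 0) (hδc₁ : δ₁ ⬝ᵥ c₁ = 0) (hc₂ : c₂ ≠ 0) (hδ₂ : δ₂ ≠ 0) (hδc₂ : δ₂ ⬝ᵥ c₂ = 0)
    (h₁ : ∀ y : ZMod p, ∃ t ∈ T₁, (t : Mat p 2) = 1 + y • vecMulVec c₁ δ₁)
    (h₂ : ∀ t ∈ T₂, ∃ y : ZMod p, (t : Mat p 2) = 1 + y • vecMulVec c₂ δ₂) :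
    δ₁ ⬝ᵥ c₂ ≠ 0 ∧ δ₂ ⬝ᵥ c₁ ≠ 0 := by
  -- if a non-zero `d` kills both centres, then `δᵢ = μᵢ d` (annihilators are lines) and
  -- `c₂ = λ c₁` (`perp_unique` for the transposed pairing): the root data are proportional
  have key : ∀ {d : Fin 2 → ZMod p}, d ≠ 0 → d ⬝ᵥ c₁ = 0 → d ⬝ᵥ c₂ = 0 →
      ∃ ν : ZMod p, vecMulVec c₂ δ₂ = ν • vecMulVec c₁ δ₁ := by
    intro d hd hd₁ hd₂
    obtain ⟨μ₁, hμ₁⟩ := perp_unique hc₁ hd hd₁ hδc₁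
    obtain ⟨μ₂, hμ₂⟩ := perp_unique hc₂ hd hd₂ hδc₂
    obtain ⟨lam, hlam⟩ := perp_unique hd hc₁ (by rw [dotProduct_comm]; exact hd₁)
      (by rw [dotProduct_comm]; exact hd₂)
    refine ⟨lam * (μ₂ * μ₁⁻¹), ?_⟩
    have hμ₁0 : μ₁ ≠ 0 := by rintro rfl; exact hδ₁ (by rw [hμ₁, zero_smul])
    have hδ₂' : δ₂ = (μ₂ * μ₁⁻¹) • δ₁ := by
      rw [hμ₂, hμ₁, smul_smul, mul_assoc, inv_mul_cancel₀ hμ₁0, mul_one]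
    rw [hlam, hδ₂', Matrix.smul_vecMulVec, Matrix.vecMulVec_smul, smul_smul]
  have hT : ∀ ν : ZMod p, vecMulVec c₂ δ₂ = ν • vecMulVec c₁ δ₁ → False := fun ν hν =>
    hne (Subgroup.eq_of_le_of_card_ge (le_of_smul h₁ h₂ hν) (by rw [hT₁, hT₂])).symm
  exact ⟨fun h0 => (key hδ₁ hδc₁ h0).elim hT, fun h0 => (key hδ₂ h0 hδc₂).elim hT⟩

end Geometry

/-! ## 3. The frame `(c₁ | c₂)` and the conjugate of `SL₂(𝔽_p)` inside `K` -/

section Frame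

variable (c₁ c₂ : Fin 2 → ZMod p)

/-- The frame with columns `c₁`, `c₂`. -/
def frame : Mat p 2 := Matrix.of fun i j => ![c₁, c₂] j i

omit hp in
/-- Column `j` of the frame. -/
theorem frame_col (j : Fin 2) : (frame c₁ c₂).col j = ![c₁, c₂] j := rfl

/-- `ψ F = (ψ(c₁), ψ(c₂))`. -/
theorem vecMul_frame (ψ : Fin 2 → ZMod p) : ψ ᵥ* frame c₁ c₂ = ![ψ ⬝ᵥ c₁, ψ ⬝ᵥ c₂] := by
  funext j; fin_cases j <;> rfl

variable {c₁ c₂}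

/-- Centres on which the other root functional does not vanish give an invertible frame. -/
theorem isUnit_frame {δ₁ δ₂ : Fin 2 → ZMod p} (hδc₁ : δ₁ ⬝ᵥ c₁ = 0) (hδc₂ : δ₂ ⬝ᵥ c₂ = 0)
    (hl : δ₁ ⬝ᵥ c₂ ≠ 0) (hm : δ₂ ⬝ᵥ c₁ ≠ 0) : IsUnit (frame c₁ c₂) := by
  rw [← Matrix.linearIndependent_cols_iff_isUnit]
  show LinearIndependent (ZMod p) ![c₁, c₂]
  refine Fintype.linearIndependent_iff.mpr fun g hg => ?_
  rw [Fin.sum_univ_two] at hg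
  simp only [Matrix.cons_val_zero, Matrix.cons_val_one] at hg
  have h1 : g 1 = 0 := by
    have h := congrArg (fun v => δ₁ ⬝ᵥ v) hg
    simp only [dotProduct_add, dotProduct_smul, hδc₁, smul_eq_mul, mul_zero, zero_add,
      dotProduct_zero, mul_eq_zero] at h
    exact h.resolve_right hl
  have h0 : g 0 = 0 := by
    have h := congrArg (fun v => δ₂ ⬝ᵥ v) hg
    simp only [dotProduct_add, dotProduct_smul, hδc₂, smul_eq_mul, mul_zero, add_zero,
      dotProduct_zero, mul_eq_zero] at h
    exact h.resolve_right hm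
  intro i
  fin_cases i <;> assumption

/-- `(1 + a · c₁ ⊗ δ₁) F = F + (a δ₁(c₂)) · c₁ ⊗ e₁` when `δ₁(c₁) = 0`. -/
theorem root_mul_frame {δ₁ : Fin 2 → ZMod p} (hδc₁ : δ₁ ⬝ᵥ c₁ = 0) (a : ZMod p) :
    (1 + a • vecMulVec c₁ δ₁) * frame c₁ c₂ =
      frame c₁ c₂ + (a * (δ₁ ⬝ᵥ c₂)) • vecMulVec c₁ (Pi.single 1 1) := by
  have hv : (![δ₁ ⬝ᵥ c₁, δ₁ ⬝ᵥ c₂] : Fin 2 → ZMod p) = (δ₁ ⬝ᵥ c₂) • Pi.single 1 1 := by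
    funext j; fin_cases j <;> simp [hδc₁]
  rw [add_mul, one_mul, Matrix.smul_mul, Matrix.vecMulVec_mul, vecMul_frame, hv,
    Matrix.vecMulVec_smul, smul_smul]

/-- `(1 + b · c₂ ⊗ δ₂) F = F + (b δ₂(c₁)) · c₂ ⊗ e₀` when `δ₂(c₂) = 0`. -/
theorem root'_mul_frame {δ₂ : Fin 2 → ZMod p} (hδc₂ : δ₂ ⬝ᵥ c₂ = 0) (b : ZMod p) :
    (1 + b • vecMulVec c₂ δ₂) * frame c₁ c₂ =
      frame c₁ c₂ + (b * (δ₂ ⬝ᵥ c₁)) • vecMulVec c₂ (Pi.single 0 1) := by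
  have hv : (![δ₂ ⬝ᵥ c₁, δ₂ ⬝ᵥ c₂] : Fin 2 → ZMod p) = (δ₂ ⬝ᵥ c₁) • Pi.single 0 1 := by
    funext j; fin_cases j <;> simp [hδc₂]
  rw [add_mul, one_mul, Matrix.smul_mul, Matrix.vecMulVec_mul, vecMul_frame, hv,
    Matrix.vecMulVec_smul, smul_smul]

/-- The root element `u_y` as `1 + y · e₀ ⊗ e₁`. -/
theorem coe_ux_eq (y : ZMod p) :
    ((ux y : SL2 p) : Mat p 2) = 1 + y • vecMulVec (Pi.single 0 1) (Pi.single 1 1) := by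
  rw [coe_ux]; ext i j; fin_cases i <;> fin_cases j <;> simp [Matrix.vecMulVec_apply]

/-- The root element `u⁻_z` as `1 + z · e₁ ⊗ e₀`. -/
theorem coe_lx_eq (z : ZMod p) :
    ((lx z : SL2 p) : Mat p 2) = 1 + z • vecMulVec (Pi.single 1 1) (Pi.single 0 1) := by
  rw [coe_lx]; ext i j; fin_cases i <;> fin_cases j <;> simp [Matrix.vecMulVec_apply]

/-- `F u_y = F + y · c₁ ⊗ e₁`. -/
theorem frame_mul_ux (y : ZMod p) :
    frame c₁ c₂ * ((ux y : SL2 p) : Mat p 2) = frame c₁ c₂ + y • vecMulVec c₁ (Pi.single 1 1) := by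
  rw [coe_ux_eq, mul_add, mul_one, Matrix.mul_smul, Matrix.mul_vecMulVec, Matrix.mulVec_single_one,
    frame_col]
  rfl

/-- `F u⁻_z = F + z · c₂ ⊗ e₀`. -/
theorem frame_mul_lx (z : ZMod p) :
    frame c₁ c₂ * ((lx z : SL2 p) : Mat p 2) = frame c₁ c₂ + z • vecMulVec c₂ (Pi.single 0 1) := by
  rw [coe_lx_eq, mul_add, mul_one, Matrix.mul_smul, Matrix.mul_vecMulVec, Matrix.mulVec_single_one,
    frame_col]
  rfl

end Frame

section Main

/-- **THEOREM (Dickson, prime field).**  Two distinct subgroups of order `p` of `GL₂(𝔽_p)`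
inside a subgroup `K` put a conjugate of `SL₂(𝔽_p)` inside `K`. -/
theorem exists_conj_sl2_subset (K T₁ T₂ : Subgroup (GLm p 2)) (hT₁ : Nat.card T₁ = p)
    (hT₂ : Nat.card T₂ = p) (hne : T₁ ≠ T₂) (h₁K : T₁ ≤ K) (h₂K : T₂ ≤ K) :
    ∃ g : GLm p 2, ∀ s : SL2 p, g * Matrix.SpecialLinearGroup.toGL s * g⁻¹ ∈ K := by
  obtain ⟨c₁, δ₁, hc₁, hδ₁, hδc₁, _hT₁e, hT₁s⟩ := subgroup_shape T₁ hT₁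
  obtain ⟨c₂, δ₂, hc₂, hδ₂, hδc₂, hT₂e, hT₂s⟩ := subgroup_shape T₂ hT₂
  obtain ⟨hl, hm⟩ := centres_independent hT₁ hT₂ hne hc₁ hδ₁ hδc₁ hc₂ hδ₂ hδc₂ hT₁s hT₂e
  have hF : IsUnit (frame c₁ c₂) := isUnit_frame hδc₁ hδc₂ hl hm
  set x : GLm p 2 := hF.unit with hx
  have hxF : (x : Mat p 2) = frame c₁ c₂ := hF.unit_spec
  refine ⟨x, ?_⟩
  let f : SL2 p →* GLm p 2 := Matrix.SpecialLinearGroup.toGL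
  let K' : Subgroup (SL2 p) := (K.comap (MulAut.conj x).toMonoidHom).comap f
  have hK' : ∀ s : SL2 p, s ∈ K' ↔ x * Matrix.SpecialLinearGroup.toGL s * x⁻¹ ∈ K := by
    intro s
    simp only [K', f, Subgroup.mem_comap, MulEquiv.coe_toMonoidHom, MulAut.conj_apply]
  have hu : ∀ y, ux y ∈ K' := by
    intro y
    rw [hK']
    obtain ⟨t, htT, hte⟩ := hT₁s (y * (δ₁ ⬝ᵥ c₂)⁻¹)
    have hxt : x * Matrix.SpecialLinearGroup.toGL (ux y) = t * x := Units.ext (by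
      rw [Units.val_mul, Units.val_mul, Matrix.SpecialLinearGroup.coe_GL_coe_matrix, hxF,
        frame_mul_ux, hte, root_mul_frame hδc₁, inv_mul_cancel_right₀ hl])
    rw [hxt, mul_inv_cancel_right]
    exact h₁K htT
  have hlK : ∀ z, lx z ∈ K' := by
    intro z
    rw [hK']
    obtain ⟨t, htT, hte⟩ := hT₂s (z * (δ₂ ⬝ᵥ c₁)⁻¹)
    have hxt : x * Matrix.SpecialLinearGroup.toGL (lx z) = t * x := Units.ext (by
      rw [Units.val_mul, Units.val_mul, Matrix.SpecialLinearGroup.coe_GL_coe_matrix, hxF,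
        frame_mul_lx, hte, root'_mul_frame hδc₂, inv_mul_cancel_right₀ hm])
    rw [hxt, mul_inv_cancel_right]
    exact h₂K htT
  intro s
  exact (hK' s).mp (OppositeRootPairs.mem_of_root_elements K' hu hlK s)

/-! ## 4. The order of `SL₂(𝔽_p)` and the order bound -/

/-- The determinant `GL₂(𝔽_p) → 𝔽_pˣ` is onto. -/
theorem det_surjective :
    Function.Surjective (Matrix.GeneralLinearGroup.det : GLm p 2 →* (ZMod p)ˣ) := by
  intro a
  have hd : (Matrix.diagonal ![(a : ZMod p), 1]).det ≠ 0 := by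
    simp [Matrix.det_diagonal, Fin.prod_univ_two]
  refine ⟨Matrix.GeneralLinearGroup.mkOfDetNeZero _ hd, Units.ext ?_⟩
  simp [Matrix.GeneralLinearGroup.val_det_apply, Matrix.det_diagonal, Fin.prod_univ_two,
    Matrix.GeneralLinearGroup.mkOfDetNeZero]

/-- The kernel of the determinant is the image of `SL₂(𝔽_p)`. -/
theorem ker_det_eq_range :
    (Matrix.GeneralLinearGroup.det : GLm p 2 →* (ZMod p)ˣ).ker =
      (Matrix.SpecialLinearGroup.toGL : SL2 p →* GLm p 2).range := by
  ext g
  refine ⟨fun hg => ?_, ?_⟩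
  · have h := congrArg (fun u : (ZMod p)ˣ => (u : ZMod p)) (MonoidHom.mem_ker.mp hg)
    exact ⟨⟨(g : Mat p 2), by simpa [Matrix.GeneralLinearGroup.val_det_apply] using h⟩,
      Units.ext rfl⟩
  · rintro ⟨s, rfl⟩
    exact MonoidHom.mem_ker.mpr (Matrix.SpecialLinearGroup.coeToGL_det s)

/-- `|SL₂(𝔽_p)| = p (p² − 1)`. -/
theorem card_SL2 : Nat.card (SL2 p) = p * (p ^ 2 - 1) := by
  set D : GLm p 2 →* (ZMod p)ˣ := Matrix.GeneralLinearGroup.det with hD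
  have hrange : Nat.card (Matrix.SpecialLinearGroup.toGL : SL2 p →* GLm p 2).range =
      Nat.card (SL2 p) :=
    Nat.card_congr (MonoidHom.ofInjective Matrix.SpecialLinearGroup.toGL_injective).toEquiv.symm
  have hquot : Nat.card (GLm p 2 ⧸ D.ker) = p - 1 := by
    rw [Nat.card_congr (QuotientGroup.quotientKerEquivOfSurjective D det_surjective).toEquiv,
      Nat.card_eq_fintype_card, ZMod.card_units]
  have hmul := Subgroup.card_eq_card_quotient_mul_card_subgroup D.ker
  rw [card_GL2, hquot, hD, ker_det_eq_range, hrange] at hmul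
  have hp1 : 0 < p - 1 := by have := hp.out.one_lt; omega
  rw [(by rw [Nat.mul_sub, mul_one, pow_two] : p ^ 2 - p = p * (p - 1))] at hmul
  exact Nat.eq_of_mul_eq_mul_left hp1 (by rw [← hmul]; ring)

/-- **ORDER BOUND.**  A subgroup of `GL₂(𝔽_p)` containing two distinct subgroups of order `p`
has order at least `p (p² − 1) = |SL₂(𝔽_p)|`. -/
theorem le_card_of_two_subgroups (K T₁ T₂ : Subgroup (GLm p 2)) (hT₁ : Nat.card T₁ = p)
    (hT₂ : Nat.card T₂ = p) (hne : T₁ ≠ T₂) (h₁K : T₁ ≤ K) (h₂K : T₂ ≤ K) :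
    p * (p ^ 2 - 1) ≤ Nat.card K := by
  obtain ⟨g, hg⟩ := exists_conj_sl2_subset K T₁ T₂ hT₁ hT₂ hne h₁K h₂K
  rw [← card_SL2]
  let f : SL2 p → K := fun s => ⟨g * Matrix.SpecialLinearGroup.toGL s * g⁻¹, hg s⟩
  have hf : Function.Injective f := by
    intro s s' h
    have h' : g * Matrix.SpecialLinearGroup.toGL s * g⁻¹ =
        g * Matrix.SpecialLinearGroup.toGL s' * g⁻¹ := congrArg (fun k : K => (k : GLm p 2)) h
    exact Matrix.SpecialLinearGroup.toGL_injective (mul_left_cancel (mul_right_cancel h'))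
  exact Nat.card_le_card_of_injective f hf

end Main

end TransvectionPairGL2
end Summit.MatrixMultiplication.MatrixMultiplication.Theorems.SubgroupIdentityDesigns.Negative
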